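/-
Origin: expansion seat `planner-pub-hodgecm-pv09-g4-0`, handover #14 2026-08-18T08:14:47Z (`HOME/pub-hodgecm-pv09-g4/lean/Pv09g4/IdelicTorusModel.lean`, md5 77cf4134, 247 lines);
landed by the gen-7 packager in gate run 26 as `HodgeCM/PerL34/IdelicTorusModel.lean` (import ^import Pv[0-9]+g[0-9]+\.→import HodgeCM.PerL34. ×3).
-/
/-
HodgeCM / PerL34 publication cell — seam S3 set-up, model side (pub-hodgecm-pv09-g4, HANDOVER #14).
WIP imports: `Pv09g4.X` ↦ `HodgeCM.PerL34.X` for X ∈ {IdelePlaces, RestrictedRegroup, RestrictedCutout};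
`HodgeCM.PerL34.NormOneRelTorus` is the landed tree file of pv11-g4 (run 25).
Complete proofs, no new axioms, nothing cited.
-/
import Summits.HodgeConjecture.HodgeCM.PerL34.IdelePlaces
import Summits.HodgeConjecture.HodgeCM.PerL34.RestrictedRegroup
import Summits.HodgeConjecture.HodgeCM.PerL34.RestrictedCutout
import Summits.HodgeConjecture.HodgeCM.PerL34.NormOneRelTorus_2

/-!
# The idelic norm-one torus `U(1)_{L/K}(𝔸_K)` as a restricted product of LOCAL groups over the places of `K`

pv11-g4's torus `relNormOneIdeles K L = ker (N : 𝔸_Lˣ → 𝔸_Lˣ)`, `N y = ∏_{σ ∈ Aut(L/K)} σ • y`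
(`HodgeCM.PerL34.NormOneRelTorus`), is a closed subgroup of `𝔸_Lˣ`.  Here it is identified, as a
TOPOLOGICAL GROUP, with a restricted product over the places `v` of `K` of local groups:

* `pl K L : Place L → Place K` (`w ↦ w ∩ K`; finite fibres, `tendsto_pl`; Galois-stable fibres,
  `pl_smul_inl/inr`);
* `Φ K L : 𝔸_Lˣ ≃ₜ* Πʳ v : Place K, [Π_{w ∣ v} L_wˣ, Π_{w ∣ v} 𝒪_wˣ]` (#13 `ideleEquiv` regrouped by #10);
* **locality of the Galois norm** `ideleEquiv_ideleGalNorm_congr`: the `w`-coordinate of `N y` depends only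
  on the coordinates of `y` at the places over `w ∩ K` (the action is `(σ • y)_w = σ_w (y_{σ⁻¹ w})`, vendored
  `FiniteAdeleRing.smul_apply` / `InfiniteAdeleRing.smul_apply`, both `rfl`);
* the LOCAL groups `locTorus K L v ≤ Π_{w ∣ v} L_wˣ` := the `v`-block projection of the torus, and
  `mem_relNormOneIdeles_iff_forall_proj_mem`: `y ∈ U(1)(𝔸_K) ↔ ∀ v, (Φ y)_v ∈ locTorus v` (from locality);
* **`torusEquiv K L : relNormOneIdeles K L ≃ₜ* Πʳ v : Place K, [locTorus K L v, (Π_{w ∣ v} 𝒪_wˣ) ⊓ locTorus v]`**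
  (#11 `cutoutEquiv`).

So the S3 end-form's abstract `Πʳ_i [G_i, B_i]` (RallisHeadline / ModelTransport, `ι` := `Place K`) is now
connected to the genuine torus by an isomorphism of topological groups; what remains per place (GAPS
pv09g4-A5 (d)) is the identification of `locTorus v` (compact at non-split `v`, `≃ₜ* K_vˣ` at split `v`) and
the rational points `U(L) = L¹` (brick (e)).
-/

set_option autoImplicit false

noncomputable section

open Topology Filter Set Sum IsDedekindDomain NumberField
open Literature.NumberTheory Literature.NumberTheory.Automorphic
open scoped RestrictedProduct

namespace HodgeCM.PerL34.IdelicTorusModel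

open IdelePlaces RestrictedRegroup RestrictedCutout

/-! ## §0  Restricting an isomorphism of topological groups to subgroups -/

section helper

variable {A A' : Type*} [Group A] [Group A'] [TopologicalSpace A] [TopologicalSpace A']

/-- An isomorphism of topological groups restricts to subgroups it matches. -/
def subgroupEquiv (e : A ≃ₜ* A') (S : Subgroup A) (S' : Subgroup A') (h : ∀ x, x ∈ S ↔ e x ∈ S') :
    S ≃ₜ* S' where
  toFun x := ⟨e x.1, (h x.1).mp x.2⟩
  invFun y := ⟨e.symm y.1, (h _).mpr (by rw [ContinuousMulEquiv.apply_symm_apply]; exact y.2)⟩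
  left_inv x := Subtype.ext (e.symm_apply_apply x.1)
  right_inv y := Subtype.ext (e.apply_symm_apply y.1)
  map_mul' x y := Subtype.ext (map_mul e x.1 y.1)
  continuous_toFun := (e.continuous.comp continuous_subtype_val).subtype_mk _
  continuous_invFun := (e.symm.continuous.comp continuous_subtype_val).subtype_mk _

/-- (Ported verbatim from the HodgeCMPerL package; no docstring in the source.) -/
@[simp] theorem coe_subgroupEquiv_apply (e : A ≃ₜ* A') (S : Subgroup A) (S' : Subgroup A')
    (h : ∀ x, x ∈ S ↔ e x ∈ S') (x : S) : ((subgroupEquiv e S S' h x : S') : A') = e x.1 := rfl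

/-- (Ported verbatim from the HodgeCMPerL package; no docstring in the source.) -/
@[simp] theorem coe_subgroupEquiv_symm_apply (e : A ≃ₜ* A') (S : Subgroup A) (S' : Subgroup A')
    (h : ∀ x, x ∈ S ↔ e x ∈ S') (y : S') : (((subgroupEquiv e S S' h).symm y : S) : A) = e.symm y.1 := rfl

end helper

variable (K L : Type) [Field K] [Field L] [Algebra K L]

/-! ## §1  Places of `L` over places of `K` -/

/-- `w ↦ w ∩ K` on all places. -/
def pl : Place L → Place K :=
  Sum.map (fun w : InfinitePlace L => w.comap (algebraMap K L))
    (fun w : HeightOneSpectrum (𝓞 L) => w.under (𝓞 K))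

/-- (Ported verbatim from the HodgeCMPerL package; no docstring in the source.) -/
@[simp] theorem pl_inl (w : InfinitePlace L) : pl K L (inl w) = inl (w.comap (algebraMap K L)) := rfl
/-- (Ported verbatim from the HodgeCMPerL package; no docstring in the source.) -/
@[simp] theorem pl_inr (w : HeightOneSpectrum (𝓞 L)) : pl K L (inr w) = inr (w.under (𝓞 K)) := rfl

section places
variable [NumberField K] [NumberField L]

/-- `pl` has finite fibres. -/
theorem tendsto_pl : Tendsto (pl K L) cofinite cofinite := by
  refine Tendsto.cofinite_of_finite_preimage_singleton fun k => ?_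
  cases k with
  | inl v =>
    refine Set.finite_coe_iff.mpr ((Set.finite_range (inl : InfinitePlace L → Place L)).subset ?_)
    rintro (w | w) hw
    · exact ⟨w, rfl⟩
    · simp [pl] at hw
  | inr v =>
    haveI : Finite {w : HeightOneSpectrum (𝓞 L) // w.under (𝓞 K) = v} :=
      finite_fib (fun w : HeightOneSpectrum (𝓞 L) => w.under (𝓞 K))
        (HeightOneSpectrum.tendsto_under_cofinite (𝓞 K) (B := 𝓞 L)) v
    have hfin : Set.Finite {w : HeightOneSpectrum (𝓞 L) | w.under (𝓞 K) = v} :=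
      Set.finite_coe_iff.mp (by assumption)
    refine Set.finite_coe_iff.mpr ((hfin.image inr).subset ?_)
    rintro (w | w) hw
    · simp [pl] at hw
    · simp only [mem_preimage, pl_inr, mem_singleton_iff, inr.injEq] at hw
      exact ⟨w, hw, rfl⟩

/-- (Ported verbatim from the HodgeCMPerL package; no docstring in the source.) -/
instance fact_tendsto_pl : Fact (Tendsto (pl K L) cofinite cofinite) := ⟨tendsto_pl K L⟩

/-- Conjugate finite places lie over the same place of `K` (vendored `under_algEquiv_smul`). -/
theorem pl_smul_inr (σ : L ≃ₐ[K] L) (w : HeightOneSpectrum (𝓞 L)) : pl K L (inr (σ • w)) = pl K L (inr w) := by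
  simp only [pl_inr, inr.injEq]
  exact HeightOneSpectrum.under_algEquiv_smul K L σ w

end places

/-- Conjugate infinite places lie over the same place of `K`. -/
theorem pl_smul_inl (σ : L ≃ₐ[K] L) (w : InfinitePlace L) : pl K L (inl (σ • w)) = pl K L (inl w) := by
  simp only [pl_inl, inl.injEq, InfinitePlace.comap_smul]
  congr 1
  exact σ.symm.toAlgHom.comp_algebraMap

/-! ## §2  The ideles regrouped over the places of `K` -/

variable [NumberField K] [NumberField L]

/-- `Π_{w ∣ v} L_wˣ`. -/
abbrev FibGroup (k : Place K) : Type := Π i : Fib (pl K L) k, LocUnits L i.1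

/-- **`𝔸_Lˣ ≃ₜ* Πʳ_v [Π_{w ∣ v} L_wˣ, Π_{w ∣ v} 𝒪_wˣ]`.** -/
def Φ : ideleGroup L ≃ₜ* Πʳ k : Place K, [FibGroup K L k, fibSubgroup (intUnits L) (pl K L) k] :=
  (ideleEquiv L).trans (regroupEquiv (intUnits L) (tendsto_pl K L))

/-- (Ported verbatim from the HodgeCMPerL package; no docstring in the source.) -/
@[simp] theorem Φ_apply (y : ideleGroup L) (k : Place K) (i : Fib (pl K L) k) :
    Φ K L y k i = ideleEquiv L y i.1 := rfl

/-- The `v`-block of an idele. -/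
def proj (k : Place K) : ideleGroup L →* FibGroup K L k :=
  (RestrictedProduct.evalMonoidHom (fun k : Place K => FibGroup K L k) k).comp (Φ K L).toMonoidHom

/-- (Ported verbatim from the HodgeCMPerL package; no docstring in the source.) -/
@[simp] theorem proj_apply (k : Place K) (y : ideleGroup L) (i : Fib (pl K L) k) :
    proj K L k y i = ideleEquiv L y i.1 := rfl

/-! ## §3  Locality of the Galois action and of the Galois norm -/

/-- `(σ • y)_w` depends only on `y` at the places over `w ∩ K`. -/
theorem ideleEquiv_smul_congr (σ : L ≃ₐ[K] L) {y y' : ideleGroup L} {i : Place L}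
    (h : ∀ j, pl K L j = pl K L i → ideleEquiv L y j = ideleEquiv L y' j) :
    ideleEquiv L (σ • y) i = ideleEquiv L (σ • y') i := by
  cases i with
  | inl w =>
    apply Units.ext
    have hj := h (inl (σ⁻¹ • w)) (pl_smul_inl K L σ⁻¹ w)
    have hj' : ((y : ideleGroup L) : AdeleRing (𝓞 L) L).1 (σ⁻¹ • w) =
        ((y' : ideleGroup L) : AdeleRing (𝓞 L) L).1 (σ⁻¹ • w) := by
      have := congrArg (fun u : (InfinitePlace.Completion (σ⁻¹ • w))ˣ => (u : (σ⁻¹ • w).Completion)) hj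
      exact this
    change ((σ • y : ideleGroup L) : AdeleRing (𝓞 L) L).1 w = ((σ • y' : ideleGroup L) : AdeleRing (𝓞 L) L).1 w
    rw [AdeleRing.coe_smul_units,
      AdeleRing.coe_smul_units,
      AdeleRing.smul_fst,
      AdeleRing.smul_fst,
      InfiniteAdeleRing.smul_apply,
      InfiniteAdeleRing.smul_apply, hj']
  | inr w =>
    apply Units.ext
    have hj := h (inr (σ⁻¹ • w)) (pl_smul_inr K L σ⁻¹ w)
    have hj' : ((y : ideleGroup L) : AdeleRing (𝓞 L) L).2 (σ⁻¹ • w) =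
        ((y' : ideleGroup L) : AdeleRing (𝓞 L) L).2 (σ⁻¹ • w) := by
      have := congrArg (fun u : ((σ⁻¹ • w).adicCompletion L)ˣ => (u : (σ⁻¹ • w).adicCompletion L)) hj
      exact this
    change ((σ • y : ideleGroup L) : AdeleRing (𝓞 L) L).2 w = ((σ • y' : ideleGroup L) : AdeleRing (𝓞 L) L).2 w
    rw [AdeleRing.coe_smul_units,
      AdeleRing.coe_smul_units,
      AdeleRing.smul_snd,
      AdeleRing.smul_snd,
      FiniteAdeleRing.smul_apply,
      FiniteAdeleRing.smul_apply, hj']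

/-- **Locality of the Galois norm**: `(N y)_w` depends only on `y` at the places over `w ∩ K`. -/
theorem ideleEquiv_ideleGalNorm_congr {y y' : ideleGroup L} {i : Place L}
    (h : ∀ j, pl K L j = pl K L i → ideleEquiv L y j = ideleEquiv L y' j) :
    ideleEquiv L (AdeleRing.ideleGalNorm K L y) i = ideleEquiv L (AdeleRing.ideleGalNorm K L y') i := by
  rw [AdeleRing.ideleGalNorm_apply, AdeleRing.ideleGalNorm_apply, map_prod, map_prod]
  rw [← RestrictedProduct.evalMonoidHom_apply (LocUnits L), map_prod,
    ← RestrictedProduct.evalMonoidHom_apply (LocUnits L), map_prod]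
  refine Finset.prod_congr rfl fun σ _ => ?_
  rw [RestrictedProduct.evalMonoidHom_apply, RestrictedProduct.evalMonoidHom_apply]
  exact ideleEquiv_smul_congr K L σ h

/-! ## §4  The local groups and the fibrewise description of the torus -/

variable [FiniteDimensional K L]

/-- **The local group at `v`**: the `v`-block projection of `U(1)_{L/K}(𝔸_K)`, a subgroup of `Π_{w ∣ v} L_wˣ`. -/
def locTorus (k : Place K) : Subgroup (FibGroup K L k) := (relNormOneIdeles K L).map (proj K L k)

/-- (Ported verbatim from the HodgeCMPerL package; no docstring in the source.) -/
theorem proj_mem_locTorus {y : ideleGroup L} (hy : y ∈ relNormOneIdeles K L) (k : Place K) :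
    proj K L k y ∈ locTorus K L k := ⟨y, hy, rfl⟩

/-- **Membership in the torus is decided block by block.** -/
theorem mem_relNormOneIdeles_iff_forall_proj_mem (y : ideleGroup L) :
    y ∈ relNormOneIdeles K L ↔ ∀ k, proj K L k y ∈ locTorus K L k := by
  refine ⟨fun hy k => proj_mem_locTorus K L hy k, fun hy => ?_⟩
  rw [mem_relNormOneIdeles_iff]
  apply (ideleEquiv L).injective
  rw [map_one]
  ext1 i
  obtain ⟨t, ht, hti⟩ := hy (pl K L i)
  have hloc : ∀ j, pl K L j = pl K L i → ideleEquiv L y j = ideleEquiv L t j := by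
    intro j hj
    have := congrFun hti ⟨j, hj⟩
    rw [proj_apply, proj_apply] at this
    exact this.symm
  rw [ideleEquiv_ideleGalNorm_congr K L hloc, (mem_relNormOneIdeles_iff K L t).mp ht, map_one]

/-- The torus corresponds to the cut-out of the local groups under `Φ`. -/
theorem mem_relNormOneIdeles_iff_mem_cutout (y : ideleGroup L) :
    y ∈ relNormOneIdeles K L ↔
      Φ K L y ∈ cutout (fun k => fibSubgroup (intUnits L) (pl K L) k) (locTorus K L) := by
  rw [mem_relNormOneIdeles_iff_forall_proj_mem, mem_cutout_iff]
  exact Iff.rfl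

/-! ## §5  The torus as a restricted product of the local groups -/

/-- **`U(1)_{L/K}(𝔸_K) ≃ₜ* Πʳ_v [U_v, U_v ∩ Π_{w ∣ v} 𝒪_wˣ]`** with `U_v = locTorus K L v ≤ Π_{w ∣ v} L_wˣ`. -/
def torusEquiv :
    relNormOneIdeles K L ≃ₜ*
      Πʳ k : Place K, [locTorus K L k,
        inH (fun k => fibSubgroup (intUnits L) (pl K L) k) (locTorus K L) k] :=
  (subgroupEquiv (Φ K L) (relNormOneIdeles K L)
      (cutout (fun k => fibSubgroup (intUnits L) (pl K L) k) (locTorus K L))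
      (mem_relNormOneIdeles_iff_mem_cutout K L)).trans
    (cutoutEquiv (fun k => fibSubgroup (intUnits L) (pl K L) k) (locTorus K L)).symm

/-- Coordinates of `torusEquiv`: the `v`-block of `y`. -/
theorem coe_torusEquiv_apply (y : relNormOneIdeles K L) (k : Place K) :
    ((torusEquiv K L y k : locTorus K L k) : FibGroup K L k) = proj K L k (y : ideleGroup L) := rfl

example : IsTopologicalGroup
    (Πʳ k : Place K, [locTorus K L k, inH (fun k => fibSubgroup (intUnits L) (pl K L) k) (locTorus K L) k]) :=
  inferInstance

end HodgeCM.PerL34.IdelicTorusModel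

end
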